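import Literature.AlgebraicGeometry.Resolution.EffectiveResolutionProofs
import Literature.AlgebraicGeometry.Resolution.EmbeddedResolutionProofs
import HarnessLib

/-!
# Discharges of named facts of `EffectiveResolution.lean`

`Literature/AlgebraicGeometry/Resolution/EffectiveResolutionDischarges.lean` — proofs-only
sibling of `EffectiveResolution.lean` (no definitions, no named facts). Each theorem below
closes a named fact `X : Prop` of that file as `X_holds : X` by composing an ACCEPTED
reduction theorem of the tree with the ACCEPTED unconditional `_holds` discharges of all of
its hypotheses; nothing is re-proved and no statement is changed. Recorded by the librarian
sweep g25 (2026-08-16, pass 5c: facts dischargeable in one line from the tree's own lemmas),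
so that the facts census, `#h21_route_deps` and the cone guardrail see these facts as
theorems.

Discharged here:

* `BierstoneGrigorievMilmanWlodarczyk2011_holds` :=
  `bierstoneGrigorievMilmanWlodarczyk2011_of_embedded'`
  `BierstoneGrigorievMilmanWlodarczyk2011_embedded_holds` (`EffectiveResolutionProofs.lean`).

## References

* [BierstoneGrigorievMilmanWlodarczyk2011] — see `lean/references.bib` and the docstring of the fact in `EffectiveResolution.lean`.
-/

namespace Literature.AlgebraicGeometry.Resolution

/-- **Discharge of the named fact `BierstoneGrigorievMilmanWlodarczyk2011`**
(`EffectiveResolution.lean`): Bierstone–Grigoriev–Milman–Włodarczyk 2011, Corollary 7.0.6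
(weak, non-embedded form for integral affine varieties). There is a function `M(d, n, l)`
(independent of the characteristic; … — obtained as
`bierstoneGrigorievMilmanWlodarczyk2011_of_embedded'` applied to the tree's unconditional
discharge `BierstoneGrigorievMilmanWlodarczyk2011_embedded_holds` of its hypothesis (reduction
in `EffectiveResolutionProofs.lean`).
[cite: BierstoneGrigorievMilmanWlodarczyk2011, Cor. 7.0.6] -/
theorem BierstoneGrigorievMilmanWlodarczyk2011_holds :
    BierstoneGrigorievMilmanWlodarczyk2011 :=
  bierstoneGrigorievMilmanWlodarczyk2011_of_embedded'
    BierstoneGrigorievMilmanWlodarczyk2011_embedded_holds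

end Literature.AlgebraicGeometry.Resolution
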